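import Summits.QuantumAdvantage.QuantumAdvantage.Theses.CubicForrelation
import Literature.Computability.QuantumComplexity.ForrelationSignTransport

/-!
# Crux `CubicForrelation.ExactPairsMaioranaMcFarland` (stmt-QuantumAdvantage-2205), stub `stub_two_adic_flats`

Line `two-adic-local-nongeneric`, stub `stub_two_adic_flats` ("criterion D, necessity"): on
`n = m + m` bits let `g` be bent with dual `f` (`W_g(b) = 2^m (-1)^{f(b)}` for all `b`) and let the
dual `f` be CUBIC (an `MvPolynomial` over `ZMod 2` of total degree `≤ 3` read at `0/1` points).
Then every codimension-`4` flat of `g` is 2-adically quadratic: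

  `2^{m-3} ∣ #{x ∈ E : g(a ⊕ x) = 1}`  for every xor-closed `E` with `|E| = 2^{2m-4}` and every `a`.

Informal proof (Carlet's flat identity + McEliece-type bookkeeping).  For `m ≤ 3` the claim is
`1 ∣ _`.  For `m ≥ 4` put `U := E^⊥` (a `16`-element xor-closed set, by the double counting
`|E|·|E^⊥| = 2ⁿ` of `Σ_u Σ_{e ∈ E} (-1)^{e·u}`, which also gives `U^⊥ = E`).  Poisson summation over
the coset `a ⊕ E` of `U^⊥` (`DerivativeWalsh.card_mul_sum_coset`) and the duality hypothesis give
`16 · (|E| - 2·wt_a) = 2^m · Σ_{u ∈ U} (-1)^{u·a} (-1)^{f(u)} = 2^m (16 - 2N)` with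
`N := #{u ∈ U : (-1)^{u·a}(-1)^{f(u)} = -1}`.  `N` is EVEN: `#{u ∈ U : (-1)^{u·a} = -1} ∈ {0, 8}`
(character sum over a subspace), and `#{u ∈ U : f(u) = 1}` is even because `Σ_{u∈U} p(u) = 0` in
`ZMod 2` for `deg p ≤ 3` — a monomial with support `S`, `|S| ≤ 3`, is `1` exactly on
`{u ∈ U : u|_S ≡ 1}`, a set of even size (pigeonhole: `2^{|S|} ≤ 8 < 16 = |U|` gives `u₁ ≠ u₂`
in `U` agreeing on `S`; `u ↦ u ⊕ u₁ ⊕ u₂` is a fixed-point-free involution of that set).  Finally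
`wt_a = 2^{2m-5} - 2^{m-1} + 2^{m-3}·(N/2)`.

Sources: C. Carlet, Two new classes of bent functions (EUROCRYPT '93) / Boolean Functions for
Cryptography and Coding Theory (2021), §6.1 (restrictions of bent functions to flats and the dual);
R. J. McEliece, weight divisibility of Reed–Muller codes (1972); O'Donnell, Analysis of Boolean
Functions (2014), §3.3 (Poisson summation).  Everything below is proved from the tree
(`ForrelationSignTransport`, `SimonFourier`, `IQPForrelation`) and Mathlib; no named facts.

What is NOT here: the bridge `forrelation f g = 1 ⇒` duality (sibling stub
`stub_dual_of_forrelation`, already landed), any use of "`g` cubic", and the local-to-global /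
Dillon steps of the line.
-/

set_option linter.dupNamespace false -- D-0017: single-problem summit ⇒ `QuantumAdvantage.QuantumAdvantage` by design

namespace Summit.QuantumAdvantage.QuantumAdvantage.Theorems.CubicForrelation.ExactPairsMaioranaMcFarland

open Finset
open Literature.Computability.QuantumComplexity
open Literature.Computability.QuantumComplexity.BuzetChailloux (bxor)
open Literature.Computability.QuantumComplexity.BuzetChailloux (zeroVec bxor_self
  bxor_bxor_cancel_left bxor_eq_zeroVec_iff twist_bxor_right twist_zeroVec_right)
open Literature.Computability.QuantumComplexity.Simon (twist_eq_one_or sum_twist)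
open Literature.Computability.QuantumComplexity.DerivativeWalsh (sum_twist_subspace
  card_mul_sum_coset)

/-! ### Counting with `±1`-valued summands -/

/-- A sum of `±1`'s over `s` is `|s| - 2 · #{-1's}`. -/
theorem taf_sum_sign {α : Type*} (s : Finset α) (t : α → ℝ)
    (ht : ∀ x ∈ s, t x = 1 ∨ t x = -1) :
    ∑ x ∈ s, t x = s.card - 2 * ((s.filter fun x => t x = -1).card : ℝ) := by
  rw [Finset.natCast_card_filter, Finset.mul_sum, eq_sub_iff_add_eq, ← Finset.sum_add_distrib,
    Finset.card_eq_sum_ones, Nat.cast_sum]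
  refine Finset.sum_congr rfl fun x hx => ?_
  rcases ht x hx with h | h <;> norm_num [h]

/-- `Σ_{x ∈ s} (-1)^{b(x)} = |s| - 2 · #{x ∈ s : b(x)}`. -/
theorem taf_sum_signOf {α : Type*} (s : Finset α) (b : α → Bool) :
    ∑ x ∈ s, signOf (b x) = s.card - 2 * ((s.filter fun x => b x = true).card : ℝ) := by
  rw [Finset.natCast_card_filter, Finset.mul_sum, eq_sub_iff_add_eq, ← Finset.sum_add_distrib,
    Finset.card_eq_sum_ones, Nat.cast_sum]
  refine Finset.sum_congr rfl fun x _ => ?_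
  rcases Bool.eq_false_or_eq_true (b x) with h | h <;> norm_num [h, signOf]

/-- `(-1)^{u·a} (-1)^{f(u)} = ±1`. -/
theorem taf_pm_one (b : Bool) {t : ℝ} (ht : t = 1 ∨ t = -1) :
    t * signOf b = 1 ∨ t * signOf b = -1 := by
  rcases ht with rfl | rfl <;> cases b <;> simp [signOf]

/-! ### The annihilator `E^⊥` of an xor-closed finset -/

/-- An xor-closed non-empty finset contains `0`. -/
theorem taf_zeroVec_mem {n : ℕ} {E : Finset (Fin n → Bool)}
    (hE : ∀ a ∈ E, ∀ b ∈ E, bxor a b ∈ E) (hne : E.Nonempty) : zeroVec ∈ E := by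
  obtain ⟨a, ha⟩ := hne
  have h := hE a ha a ha
  rwa [bxor_self] at h

/-- `E^⊥ = {u : (-1)^{e·u} = 1 ∀ e ∈ E}` is closed under `⊕`. -/
theorem taf_perp_add {n : ℕ} (E : Finset (Fin n → Bool)) :
    ∀ u ∈ (univ.filter fun u : Fin n → Bool => ∀ e ∈ E, twist e u = 1),
      ∀ v ∈ (univ.filter fun u : Fin n → Bool => ∀ e ∈ E, twist e u = 1),
        bxor u v ∈ (univ.filter fun u : Fin n → Bool => ∀ e ∈ E, twist e u = 1) := by
  intro u hu v hv
  simp only [Finset.mem_filter, Finset.mem_univ, true_and] at hu hv ⊢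
  intro e he
  rw [twist_bxor_right, hu e he, hv e he, mul_one]

/-- **Double counting** `Σ_u Σ_{e ∈ E} (-1)^{e·u}`: `|E| · |E^⊥| = 2ⁿ` for an xor-closed `E ∋ 0`. -/
theorem taf_card_mul_card_perp {n : ℕ} {E : Finset (Fin n → Bool)}
    (hE : ∀ a ∈ E, ∀ b ∈ E, bxor a b ∈ E) (h0 : zeroVec ∈ E) :
    (E.card : ℝ) * ((univ.filter fun u : Fin n → Bool => ∀ e ∈ E, twist e u = 1).card : ℝ) =
      (2 : ℝ) ^ n := by
  have h1 : ∑ u : Fin n → Bool, ∑ e ∈ E, twist e u =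
      (E.card : ℝ) * ((univ.filter fun u : Fin n → Bool => ∀ e ∈ E, twist e u = 1).card : ℝ) := by
    rw [Finset.sum_congr rfl fun u _ => sum_twist_subspace hE u, ← Finset.sum_filter,
      Finset.sum_const, nsmul_eq_mul, mul_comm]
  have h2 : ∑ u : Fin n → Bool, ∑ e ∈ E, twist e u = (2 : ℝ) ^ n := by
    rw [Finset.sum_comm, Finset.sum_congr rfl fun e _ => sum_twist e, Finset.sum_ite_eq',
      if_pos (show ((fun _ => false) : Fin n → Bool) ∈ E from h0)]
  rw [← h1, h2]

/-- **Bi-annihilator**: `(E^⊥)^⊥ = E` for an xor-closed `E ∋ 0` (from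
`|E|·|E^⊥| = 2ⁿ = |E^⊥|·|E^⊥⊥|` and `E ⊆ E^⊥⊥`). -/
theorem taf_perp_perp_eq {n : ℕ} {E : Finset (Fin n → Bool)}
    (hE : ∀ a ∈ E, ∀ b ∈ E, bxor a b ∈ E) (h0 : zeroVec ∈ E) :
    (univ.filter fun y : Fin n → Bool =>
        ∀ u ∈ (univ.filter fun u : Fin n → Bool => ∀ e ∈ E, twist e u = 1), twist u y = 1) = E := by
  set U := (univ.filter fun u : Fin n → Bool => ∀ e ∈ E, twist e u = 1) with hU
  have hUadd : ∀ u ∈ U, ∀ v ∈ U, bxor u v ∈ U := taf_perp_add E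
  have h0U : zeroVec ∈ U :=
    Finset.mem_filter.2 ⟨Finset.mem_univ _, fun e _ => twist_zeroVec_right e⟩
  have h1 := taf_card_mul_card_perp hE h0
  have h2 := taf_card_mul_card_perp hUadd h0U
  have hsub : E ⊆ (univ.filter fun y : Fin n → Bool => ∀ u ∈ U, twist u y = 1) := by
    intro y hy
    simp only [Finset.mem_filter, Finset.mem_univ, true_and]
    intro u hu
    rw [twist_comm]
    exact (Finset.mem_filter.1 hu).2 y hy
  refine (Finset.eq_of_subset_of_card_le hsub ?_).symm
  have hpos : (0 : ℝ) < U.card := by exact_mod_cast Finset.card_pos.2 ⟨_, h0U⟩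
  have h3 : (((univ.filter fun y : Fin n → Bool => ∀ u ∈ U, twist u y = 1).card : ℕ) : ℝ) =
      E.card := by
    apply mul_left_cancel₀ hpos.ne'
    rw [h2, mul_comm, h1]
  exact_mod_cast h3.le

/-- Reindexing the coset: `Σ_{y : a ⊕ y ∈ U^⊥} G(y) = Σ_{x ∈ E} G(a ⊕ x)` when `U^⊥ = E`. -/
theorem taf_sum_coset_shift {n : ℕ} {E U : Finset (Fin n → Bool)}
    (hperp : (univ.filter fun y : Fin n → Bool => ∀ u ∈ U, twist u y = 1) = E)
    (G : (Fin n → Bool) → ℝ) (a : Fin n → Bool) :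
    ∑ y ∈ univ.filter (fun y => ∀ u ∈ U, twist u (bxor a y) = 1), G y =
      ∑ x ∈ E, G (bxor a x) := by
  subst hperp
  symm
  refine Finset.sum_nbij' (fun x => bxor a x) (fun y => bxor a y) ?_ ?_ ?_ ?_ ?_
  · intro x hx
    simp only [Finset.mem_filter, Finset.mem_univ, true_and] at hx ⊢
    intro u hu
    rw [bxor_bxor_cancel_left]
    exact hx u hu
  · intro y hy
    simp only [Finset.mem_filter, Finset.mem_univ, true_and] at hy ⊢
    exact hy
  · intro x _
    exact bxor_bxor_cancel_left a x
  · intro y _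
    exact bxor_bxor_cancel_left a y
  · intro x _
    rfl

/-- **Carlet's flat identity, counted**: for `g` with `W_g = c · (-1)^f`, `U` xor-closed with
`U^⊥ = E`, and any shift `a`:
`|U| · (|E| - 2·#{x ∈ E : g(a ⊕ x)}) = c · (|U| - 2·#{u ∈ U : (-1)^{u·a}(-1)^{f(u)} = -1})`. -/
theorem taf_flat_count {n : ℕ} (f g : (Fin n → Bool) → Bool) (c : ℝ)
    (hW : ∀ b : Fin n → Bool, DerivativeWalsh.W (fun x => signOf (g x)) b = c * signOf (f b))
    {E U : Finset (Fin n → Bool)} (hUadd : ∀ a ∈ U, ∀ b ∈ U, bxor a b ∈ U)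
    (hperp : (univ.filter fun y : Fin n → Bool => ∀ u ∈ U, twist u y = 1) = E)
    (a : Fin n → Bool) :
    (U.card : ℝ) * (E.card - 2 * ((E.filter fun x => g (bxor a x) = true).card : ℝ)) =
      c * (U.card - 2 * ((U.filter fun u => twist u a * signOf (f u) = -1).card : ℝ)) := by
  have key := card_mul_sum_coset hUadd (fun y => signOf (g y)) a
  rw [taf_sum_coset_shift hperp (fun y => signOf (g y)) a,
    taf_sum_signOf E (fun x => g (bxor a x))] at key
  have h1 : ∑ x ∈ U, twist x a * DerivativeWalsh.W (fun y => signOf (g y)) x =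
      c * ∑ u ∈ U, twist u a * signOf (f u) := by
    rw [Finset.mul_sum]
    exact Finset.sum_congr rfl fun u _ => by rw [hW u]; ring
  rw [key, h1, taf_sum_sign U (fun u => twist u a * signOf (f u))
    fun u _ => taf_pm_one (f u) (twist_eq_one_or u a)]

/-! ### Parity: degree `≤ 3` gives even weight on a `16`-element xor-closed set -/

/-- A finset stable under the fixed-point-free involution `u ↦ u ⊕ w` (`w ≠ 0`) has even size. -/
theorem taf_even_card_of_invol {n : ℕ} {w : Fin n → Bool} (hw : w ≠ zeroVec)
    (A : Finset (Fin n → Bool)) (hA : ∀ u ∈ A, bxor u w ∈ A) : Even A.card := by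
  have hsum : ∑ _u ∈ A, (1 : ZMod 2) = 0 := by
    refine Finset.sum_involution (fun u _ => bxor u w) (fun _ _ => by decide) ?_
      (fun u hu => hA u hu) ?_
    · intro u _ _ h
      apply hw
      have h' := congrArg (bxor u) h
      rwa [bxor_bxor_cancel_left, bxor_self] at h'
    · intro u _
      funext i
      show ((u i ^^ w i) ^^ w i) = u i
      cases u i <;> cases w i <;> rfl
  rw [Finset.sum_const, nsmul_eq_mul, mul_one] at hsum
  exact ZMod.natCast_eq_zero_iff_even.1 hsum

/-- **Pigeonhole + involution**: in an xor-closed `U` with `2^{|S|} < |U|`, the number of `u ∈ U`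
with `u|_S ≡ 1` is even. -/
theorem taf_even_card_filter_forall {n : ℕ} {U : Finset (Fin n → Bool)}
    (hUadd : ∀ a ∈ U, ∀ b ∈ U, bxor a b ∈ U) (S : Finset (Fin n)) (hS : 2 ^ S.card < U.card) :
    Even (U.filter fun u => ∀ i ∈ S, u i = true).card := by
  classical
  obtain ⟨u₁, hu₁, u₂, hu₂, hne, heq⟩ := Finset.exists_ne_map_eq_of_card_lt_of_maps_to
    (t := (Finset.univ : Finset (S → Bool))) (f := fun (u : Fin n → Bool) (i : S) => u i)
    (by rwa [Finset.card_univ, Fintype.card_fun, Fintype.card_bool, Fintype.card_coe])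
    (fun _ _ => Finset.mem_coe.2 (Finset.mem_univ _))
  have hw0 : bxor u₁ u₂ ≠ zeroVec := fun h => hne ((bxor_eq_zeroVec_iff u₁ u₂).1 h)
  have hwS : ∀ i ∈ S, bxor u₁ u₂ i = false := by
    intro i hi
    have h := congrFun heq ⟨i, hi⟩
    simp only at h
    show (u₁ i ^^ u₂ i) = false
    rw [h, Bool.xor_self]
  refine taf_even_card_of_invol hw0 _ fun u hu => ?_
  rw [Finset.mem_filter] at hu ⊢
  refine ⟨hUadd u hu.1 _ (hUadd u₁ hu₁ u₂ hu₂), fun i hi => ?_⟩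
  show (u i ^^ bxor u₁ u₂ i) = true
  rw [hwS i hi, hu.2 i hi]
  rfl

/-- A monomial with exponent vector `d`, read at a `0/1` point, is the indicator of
`u|_{supp d} ≡ 1`. -/
theorem taf_prod_indicator {n : ℕ} (d : Fin n →₀ ℕ) (u : Fin n → Bool) :
    ∏ i ∈ d.support, (if u i then (1 : ZMod 2) else 0) ^ d i =
      if (∀ i ∈ d.support, u i = true) then 1 else 0 := by
  split_ifs with h
  · refine Finset.prod_eq_one fun i hi => ?_
    rw [h i hi, if_pos rfl, one_pow]
  · push Not at h
    obtain ⟨i, hi, hui⟩ := h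
    refine Finset.prod_eq_zero hi ?_
    simp [hui, Finsupp.mem_support_iff.1 hi]

/-- A monomial involves at most as many variables as its degree. -/
theorem taf_card_support_le {n : ℕ} (d : Fin n →₀ ℕ) : d.support.card ≤ d.sum fun _ e => e := by
  rw [Finsupp.sum, Finset.card_eq_sum_ones]
  exact Finset.sum_le_sum fun i hi => Nat.one_le_iff_ne_zero.2 (Finsupp.mem_support_iff.1 hi)

/-- **Degree `≤ 3` polynomials sum to zero over a large xor-closed set**: if `|U| > 8` then
`Σ_{u ∈ U} p(u) = 0` in `ZMod 2` for `p.totalDegree ≤ 3`. -/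
theorem taf_sum_eval_eq_zero {n : ℕ} (p : MvPolynomial (Fin n) (ZMod 2)) (hp : p.totalDegree ≤ 3)
    {U : Finset (Fin n → Bool)} (hUadd : ∀ a ∈ U, ∀ b ∈ U, bxor a b ∈ U) (hU : 8 < U.card) :
    ∑ u ∈ U, MvPolynomial.eval (fun j => if u j then (1 : ZMod 2) else 0) p = 0 := by
  simp_rw [MvPolynomial.eval_eq]
  rw [Finset.sum_comm]
  refine Finset.sum_eq_zero fun d hd => ?_
  rw [← Finset.mul_sum, Finset.sum_congr rfl fun u _ => taf_prod_indicator d u, Finset.sum_boole]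
  have h3 : d.support.card ≤ 3 :=
    (taf_card_support_le d).trans ((MvPolynomial.le_totalDegree hd).trans hp)
  have hlt : 2 ^ d.support.card < U.card :=
    calc 2 ^ d.support.card ≤ 2 ^ 3 := Nat.pow_le_pow_right (by norm_num) h3
      _ = 8 := by norm_num
      _ < U.card := hU
  rw [ZMod.natCast_eq_zero_iff_even.2 (taf_even_card_filter_forall hUadd d.support hlt), mul_zero]

/-- The `f`-part of the parity: `#{u ∈ U : f(u)} ≡ 0 (mod 2)` for cubic `f` and `|U| > 8`. -/
theorem taf_f_sum {n : ℕ} (f : (Fin n → Bool) → Bool) (p : MvPolynomial (Fin n) (ZMod 2))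
    (hp : p.totalDegree ≤ 3)
    (hf : ∀ x, f x = decide (MvPolynomial.eval (fun j => if x j then (1 : ZMod 2) else 0) p = 1))
    {U : Finset (Fin n → Bool)} (hUadd : ∀ a ∈ U, ∀ b ∈ U, bxor a b ∈ U) (hU : 8 < U.card) :
    ∑ u ∈ U, (if f u = true then (1 : ZMod 2) else 0) = 0 := by
  have h01 : ∀ z : ZMod 2, z = 0 ∨ z = 1 := by decide
  have hpt : ∀ u : Fin n → Bool, (if f u = true then (1 : ZMod 2) else 0) =
      MvPolynomial.eval (fun j => if u j then (1 : ZMod 2) else 0) p := by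
    intro u
    rw [hf u]
    rcases h01 (MvPolynomial.eval (fun j => if u j then (1 : ZMod 2) else 0) p) with h | h <;>
      rw [h] <;> decide
  rw [Finset.sum_congr rfl fun u _ => hpt u]
  exact taf_sum_eval_eq_zero p hp hUadd hU

/-- The character part of the parity: `#{u ∈ U : (-1)^{u·a} = -1} ∈ {0, 8}` is even for a
`16`-element xor-closed `U`. -/
theorem taf_twist_sum {n : ℕ} {U : Finset (Fin n → Bool)}
    (hUadd : ∀ a ∈ U, ∀ b ∈ U, bxor a b ∈ U) (hU16 : U.card = 16) (a : Fin n → Bool) :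
    ∑ u ∈ U, (if twist u a = -1 then (1 : ZMod 2) else 0) = 0 := by
  rw [Finset.sum_boole]
  have hs := sum_twist_subspace hUadd a
  rw [taf_sum_sign U (fun u => twist u a) fun u _ => twist_eq_one_or u a, hU16] at hs
  push_cast at hs
  split_ifs at hs with h
  · have h0 : ((U.filter fun u => twist u a = -1).card : ℝ) = 0 := by linarith
    rw [show (U.filter fun u => twist u a = -1).card = 0 by exact_mod_cast h0, Nat.cast_zero]
  · have h8 : ((U.filter fun u => twist u a = -1).card : ℝ) = 8 := by linarith
    rw [show (U.filter fun u => twist u a = -1).card = 8 by exact_mod_cast h8]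
    decide

/-- **`N` is even**: `2 ∣ #{u ∈ U : (-1)^{u·a} (-1)^{f(u)} = -1}` for cubic `f` and a `16`-element
xor-closed `U` (the only place where "`f` cubic" enters). -/
theorem taf_two_dvd_N {n : ℕ} (f : (Fin n → Bool) → Bool) (p : MvPolynomial (Fin n) (ZMod 2))
    (hp : p.totalDegree ≤ 3)
    (hf : ∀ x, f x = decide (MvPolynomial.eval (fun j => if x j then (1 : ZMod 2) else 0) p = 1))
    {U : Finset (Fin n → Bool)} (hUadd : ∀ a ∈ U, ∀ b ∈ U, bxor a b ∈ U) (hU16 : U.card = 16)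
    (a : Fin n → Bool) :
    2 ∣ (U.filter fun u => twist u a * signOf (f u) = -1).card := by
  rw [← ZMod.natCast_eq_zero_iff, Finset.natCast_card_filter]
  have hne : (1 : ℝ) ≠ -1 := by norm_num
  have hpt : ∀ u : Fin n → Bool, (if twist u a * signOf (f u) = -1 then (1 : ZMod 2) else 0) =
      (if twist u a = -1 then (1 : ZMod 2) else 0) + (if f u = true then (1 : ZMod 2) else 0) := by
    intro u
    rcases twist_eq_one_or u a with h | h <;> cases f u <;> simp [h, signOf, hne]
    decide
  rw [Finset.sum_congr rfl fun u _ => hpt u, Finset.sum_add_distrib, taf_twist_sum hUadd hU16 a,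
    taf_f_sum f p hp hf hUadd (by omega), add_zero]

/-! ### Assembly -/

/-- The 2-adic bookkeeping: `16 (2^{2m-4} - 2 wt) = 2^m (16 - 4t)` with `m ≥ 4` forces
`wt = 2^{m-3} (2^{m-2} - 4 + t)`. -/
theorem taf_arith {m wt t : ℕ} (hm : 4 ≤ m)
    (h : ((16 : ℕ) : ℝ) * (((2 ^ (m + m - 4) : ℕ) : ℝ) - 2 * (wt : ℝ)) =
      (2 : ℝ) ^ m * (((16 : ℕ) : ℝ) - 2 * ((2 * t : ℕ) : ℝ))) :
    2 ^ (m - 3) ∣ wt := by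
  obtain ⟨k, rfl⟩ : ∃ k, m = k + 4 := ⟨m - 4, by omega⟩
  rw [show k + 4 - 3 = k + 1 by omega]
  rw [show k + 4 + (k + 4) - 4 = k + k + 4 by omega] at h
  push_cast at h
  have hr : ((wt + 2 ^ (k + 1) * 4 : ℕ) : ℝ) = ((2 ^ (k + 1) * (2 ^ (k + 2) + t) : ℕ) : ℝ) := by
    push_cast
    apply mul_left_cancel₀ (by norm_num : (32 : ℝ) ≠ 0)
    linear_combination (-1 : ℝ) * h
  have hn : wt + 2 ^ (k + 1) * 4 = 2 ^ (k + 1) * (2 ^ (k + 2) + t) := by exact_mod_cast hr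
  have h1 : 2 ^ (k + 1) ∣ wt + 2 ^ (k + 1) * 4 := by
    rw [hn]
    exact dvd_mul_right _ _
  have h2 := Nat.dvd_sub h1 (dvd_mul_right (2 ^ (k + 1)) 4)
  rwa [Nat.add_sub_cancel] at h2

/-- The core, for a given annihilator pair `U^⊥ = E` with `|U| = 16`. -/
theorem taf_core {n m : ℕ} (hm : 4 ≤ m) (f g : (Fin n → Bool) → Bool)
    (p : MvPolynomial (Fin n) (ZMod 2)) (hp : p.totalDegree ≤ 3)
    (hf : ∀ x, f x = decide (MvPolynomial.eval (fun j => if x j then (1 : ZMod 2) else 0) p = 1))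
    (hW : ∀ b : Fin n → Bool,
      DerivativeWalsh.W (fun x => signOf (g x)) b = (2 : ℝ) ^ m * signOf (f b))
    {E U : Finset (Fin n → Bool)} (hUadd : ∀ a ∈ U, ∀ b ∈ U, bxor a b ∈ U)
    (hperp : (univ.filter fun y : Fin n → Bool => ∀ u ∈ U, twist u y = 1) = E)
    (hU16 : U.card = 16) (hcard : E.card = 2 ^ (m + m - 4)) (a : Fin n → Bool) :
    2 ^ (m - 3) ∣ (E.filter fun x => g (bxor a x) = true).card := by
  have key := taf_flat_count f g ((2 : ℝ) ^ m) hW hUadd hperp a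
  obtain ⟨t, ht⟩ := taf_two_dvd_N f p hp hf hUadd hU16 a
  rw [hU16, ht, hcard] at key
  exact taf_arith hm key

/-- **Criterion D, necessity** (Carlet's flat identity + McEliece bookkeeping).  On `m + m` bits, if
`g` is bent with dual `f` (`W_g(b) = 2^m (-1)^{f(b)}`) and `f` is CUBIC, then for every xor-closed
`E` with `|E| = 2^{2m-4}` and every shift `a`, `2^{m-3} ∣ #{x ∈ E : g(a ⊕ x) = 1}` — every
codimension-`4` flat of `g` carries the weight divisibility of a quadratic function. -/
theorem stub_two_adic_flats :
    ∀ (m : ℕ) (f g : (Fin (m + m) → Bool) → Bool),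
      (∃ p : MvPolynomial (Fin (m + m)) (ZMod 2), p.totalDegree ≤ 3 ∧
        ∀ x, f x = decide (MvPolynomial.eval (fun j => if x j then (1 : ZMod 2) else 0) p = 1)) →
      (∀ b : Fin (m + m) → Bool,
        DerivativeWalsh.W (fun x => signOf (g x)) b = (2 : ℝ) ^ m * signOf (f b)) →
      ∀ E : Finset (Fin (m + m) → Bool), (∀ a ∈ E, ∀ b ∈ E, bxor a b ∈ E) →
        E.card = 2 ^ (m + m - 4) →
        ∀ a : Fin (m + m) → Bool, 2 ^ (m - 3) ∣ (E.filter fun x => g (bxor a x) = true).card := by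
  intro m f g hf hW E hE hcard a
  rcases Nat.lt_or_ge m 4 with hm | hm
  · rw [show m - 3 = 0 by omega, pow_zero]
    exact one_dvd _
  obtain ⟨p, hp, hfp⟩ := hf
  have h0E : zeroVec ∈ E :=
    taf_zeroVec_mem hE (Finset.card_pos.1 (by rw [hcard]; positivity))
  have hEU := taf_card_mul_card_perp hE h0E
  have h2 : (2 : ℝ) ^ (m + m) = 2 ^ (m + m - 4) * 16 := by
    rw [show (16 : ℝ) = 2 ^ 4 by norm_num, ← pow_add]
    exact congrArg (fun k : ℕ => (2 : ℝ) ^ k) (by omega)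
  rw [hcard, h2] at hEU
  push_cast at hEU
  exact taf_core hm f g p hp hfp hW (taf_perp_add E) (taf_perp_perp_eq hE h0E)
    (by exact_mod_cast mul_left_cancel₀ (by positivity) hEU) hcard a

end Summit.QuantumAdvantage.QuantumAdvantage.Theorems.CubicForrelation.ExactPairsMaioranaMcFarland
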